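import Summits.AtomisticToContinuum.BoseEinsteinCondensation.Theorems.BECGroundStateSOSPeriodicIRBoundTwoSectorZeroDefs
import HarnessLib

/-!
# Route `BECGroundStateSOS`, crux `PeriodicIRBound` (stmt-AtomisticToContinuum-3972), line `two-sector-gd-transfer` —
# v9 Defs, part 2: the LOW-MOMENTUM (Goldstone) window, and the `C⁺`-arrow split into sized stubs

Sequel of `…TwoSectorZeroDefs.lean` (p158945, lead c23). There the floating two-channel bound on momentum-zero
near-minimisers `FloatingForZero v K ρ₀ C A` was typed with the v7 window `2π‖n‖_∞/L ≤ K` — a FIXED momentum ball,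
inherited from stmt-12620's `GDFor`. Two facts force a second axis of the reshape:

* the crux itself only constrains the low-momentum window `‖n‖_∞ ≤ κ√ρ·L`, i.e. `|p| ≲ 2πκ√ρ` (shrinking with `ρ`), and so
  does line 1's spectral floor `C⁺ = LinearFloorFor v` (`‖k‖² ≤ Cρ`); hence the arrow `C⁺ ⇒ FloatingForZero` claimed for the
  fixed-`K` window (strategist s2 census v3 §1.4; `LinearFloorGivesFloatingZero` of part 1) has NO source of information on
  the modes `Cρ < |p|² ≤ K²` and is not expected to be provable as typed — it is superseded here;
* nothing in the landed endgame needs the fixed ball: `stub_windowAssemblyT` (p153397) shrinks `ρ₀` precisely to push the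
  crux window inside the `K`-ball.

So the pooled load is typed on the window it is consumed on: `FloatingForLow v K ρ₀ C A` asks the two momentum-zero channel
inequalities (relaxed guard `−Aρ ≤ μ₊`) for the modes `2π‖n‖_∞/L ≤ K√ρ` only, and the pooled stub S1₀ of the v9 skeleton is
`FloatingTwoChannelLow := ∀ v` integrable admissible, `∀ K > 0, ∃ ρ₀ C > 0, ∃ A ≥ 0, FloatingForLow v K ρ₀ C A` — weaker than
part 1's `FloatingTwoChannelZero` (`floatingTwoChannelLow_of_floatingTwoChannelZero`: shrink `ρ₀` so that `K√ρ ≤ K₁`), hence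
than S1' and than stmt-12620 ∧ stmt-9094, and (modulo the provable stubs S9a/S9b/S9c/S9' below) implied by `C⁺`.

Contents: §1 `FloatingForLow`, `FloatingTwoChannelLow` (S1₀), `IRBoundZeroWith`; §2 stub statements — S5₀ `WindowAssemblyTLow`,
S9a `ChannelsOfSectorGaps` (fixed `(N, L)`: two real sector gaps against `E₀(N) ± μ` give the two momentum-zero channel
inequalities — the sector variational principle on the exact-momentum test vectors), S9c `LatticeSectorEnergyFinite`
(`E_M(2πn/L) < ⊤` for integrable `v`), S9b `LinearFloorGivesFloatingLowOf` (S9c → S9a → (`C⁺ ⇒` S1₀ per potential with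
`∫v ≠ 0`)), S9' `AeZeroFloatingLow`; §3 sorry-free glue, including the registered by-product `stub_integrableHalfOfFloatingLow`
and `periodicIRBound_of_floatingLow` (S1₀ ∧ S4₀ ∧ S5₀ ∧ S6 ⇒ crux by name). Statements of a proof plan, not results in print
(shape after Kennedy–Lieb–Shastry, J. Stat. Phys. 53 (1988) 1019, (12)–(14); sectors as in Cornean–Dereziński–Ziń, J. Math.
Phys. 50 (2009) 062103, §1.1).
-/

noncomputable section

open scoped BigOperators ENNReal ComplexConjugate
open Filter MeasureTheory

namespace Summit.AtomisticToContinuum.BoseEinsteinCondensation.Cruxes.PeriodicIRBound.TwoSectorGdTransfer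

open Literature.MathematicalPhysics.QuantumManyBody.BoseGas
open Summit.AtomisticToContinuum.BoseEinsteinCondensation.Theses.BECGroundStateSOS (PeriodicIRBound)
open Summit.AtomisticToContinuum.BoseEinsteinCondensation.Theses.BECTwoSectorGD (GaussianDomination)
open Summit.AtomisticToContinuum.BoseEinsteinCondensation.Theses.BECSectorPoincareTwoScale (EnergyConvexityWindow)
open Summit.AtomisticToContinuum.BoseEinsteinCondensation.Theorems.PeriodicIRBound.Negative
  (IRBoundFor IRBoundWith NearMin InWindow IRIneq irBoundFor_iff periodicIRBound_iff_split)
open Summit.AtomisticToContinuum.BoseEinsteinCondensation.Cruxes.PeriodicIRBound.LinearPhFloorWagner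
  (LinearFloorFor LinearParticleHoleFloor WF.qform)

/-! ## §1 The low-momentum floating bound, the pooled stub S1₀, and the `With`-form of `IRBoundForZero` -/

/-- **The relaxed floating two-channel bound on momentum-zero near-minimisers, LOW-MOMENTUM WINDOW, for ONE potential
with data `(K, ρ₀, C, A)`**: as `FloatingForZero v K ρ₀ C A` (part 1) but asked only for the modes
`2π‖n‖_∞/L ≤ K·√ρ` (the crux's own window `‖n‖_∞ ≤ κ√ρL` at `K = 2πκ`): for every `ε > 0` and `ρ < ρ₀`, eventually in
`N = m + 2`, each such mode admits `μ₊ ≥ −Aρ`, `μ₋ ≤ μ₊ + ε√(ρa)/L` with `ChanPlusZero` against `E₀(N) + μ₊` and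
`ChanMinusZero` against `E₀(N) − μ₋`, bound `b = CL²/‖n‖²_∞`. A statement of the proof plan, not a result in print. -/
def FloatingForLow (v : ℝ → ℝ≥0∞) (K ρ₀ C A : ℝ) : Prop :=
  ∀ ε : ℝ, 0 < ε → ∀ ρ : ℝ, 0 < ρ → ρ < ρ₀ → ∀ᶠ m : ℕ in atTop,
    ∀ n : Fin 3 → ℤ, n ≠ 0 → 2 * Real.pi / sideLength ρ (m + 2) * ‖(fun j => (n j : ℝ))‖ ≤ K * Real.sqrt ρ →
      ∃ μp μm : ℝ, -(A * ρ) ≤ μp ∧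
        μm ≤ μp + ε * Real.sqrt (ρ * (scatteringLength v).toReal) / sideLength ρ (m + 2) ∧
        ChanPlusZero v m (sideLength ρ (m + 2)) n
            ((periodicGroundStateEnergy v (m + 2) (sideLength ρ (m + 2))).toReal + μp)
            (C * sideLength ρ (m + 2) ^ 2 / ‖(fun j => (n j : ℝ))‖ ^ 2) ∧
          ChanMinusZero v m (sideLength ρ (m + 2)) n
            ((periodicGroundStateEnergy v (m + 2) (sideLength ρ (m + 2))).toReal - μm)
            (C * sideLength ρ (m + 2) ^ 2 / ‖(fun j => (n j : ℝ))‖ ^ 2)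

/-- **Stub S1₀ statement — the pooled load of the v9 skeleton (open-problem strength)**: for every integrable
admissible `v` and every window constant `K > 0` there are `ρ₀, C > 0`, `A ≥ 0` with `FloatingForLow v K ρ₀ C A`.
Weaker than part 1's `FloatingTwoChannelZero` (`floatingTwoChannelLow_of_floatingTwoChannelZero`), hence than S1'
`FloatingTwoChannel` and than stmt-12620 ∧ stmt-9094 (`floatingTwoChannelLow_of_pooled`); implied by line 1's `C⁺`
(`floatingTwoChannelLow_of_linearFloor`, modulo S9a/S9b/S9c/S9'); implies the integrable half of the crux
(`integrableHalf_of_floatingLow`, modulo S4₀, S5₀), hence torus thermodynamic-limit BEC for integrable `v`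
(`…DifficultyFloorR2`). Per mode it asks a first-moment (mean) Landau floor of size `(n_k+1)/b` resp. `n_k/b` in the
particle resp. hole channel on the EXACT-momentum test vectors `a†(φ_n)Ψ`, `a(φ_n)Ψ`, measured from a common floating
chemical potential. A statement of the proof plan, not a result in print. -/
def FloatingTwoChannelLow : Prop :=
  ∀ v : ℝ → ℝ≥0∞, IsRepulsiveFiniteRange v → (∫⁻ x : Space, v ‖x‖) ≠ ⊤ →
    ∀ K : ℝ, 0 < K → ∃ ρ₀ : ℝ, 0 < ρ₀ ∧ ∃ C : ℝ, 0 < C ∧ ∃ A : ℝ, 0 ≤ A ∧ FloatingForLow v K ρ₀ C A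

/-- The infrared inequality on momentum-zero near-minimisers with the constants made explicit
(`IRBoundForZero v ↔ ∀ κ > 0, ∃ ρ₀ > 0, ∃ C > 0, IRBoundZeroWith v κ ρ₀ C`, `Iff.rfl`). [folklore] -/
def IRBoundZeroWith (v : ℝ → ℝ≥0∞) (κ ρ₀ C : ℝ) : Prop :=
  ∀ ρ : ℝ, 0 < ρ → ρ < ρ₀ → ∀ᶠ N : ℕ in atTop, ∃ δ : ℝ≥0∞, 0 < δ ∧
    ∀ Ψ : PeriodicTrialState N (sideLength ρ N), NearMin v ρ N δ Ψ → HasTotalMomentum 0 Ψ.ψ →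
      ∀ k : Fin 3 → ℤ, InWindow κ ρ N k → IRIneq C ρ N Ψ.ψ k

/-- `IRBoundForZero` is the `∀ κ ∃ ρ₀ C` closure of `IRBoundZeroWith`. [folklore] -/
theorem irBoundForZero_iff (v : ℝ → ℝ≥0∞) :
    IRBoundForZero v ↔ ∀ κ : ℝ, 0 < κ → ∃ ρ₀ : ℝ, 0 < ρ₀ ∧ ∃ C : ℝ, 0 < C ∧ IRBoundZeroWith v κ ρ₀ C :=
  Iff.rfl

/-! ## §2 Statements of the v9 stubs (part 2) -/

/-- **Stub S5₀ statement — window arithmetic and the scalar endgame on momentum-zero states, relaxed guard, low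
window**: for an integrable admissible `v` and `κ > 0`, `FloatingForLow v (2πκ) ρ₀ C A` and `KLSMomentForTZero v` give
`IRBoundZeroWith v κ ρ₀ C'` for some `C' > 0` (plan: `C' = C√a + 2κ + √((12π²C+1)κ² + 2C(‖v‖₁ + A/2))`; the landed S5'
`stub_windowAssemblyT` p153397 verbatim with the momentum hypothesis threaded, `Aρ` absorbed into the f-sum constant —
the energy combination is `(μ₋ − μ₊)n_k − μ₊ ≤ e·n_k + Aρ`, so `WindowArith.nk_le` is called with `W + Aρ`, `V₁ + A/2` —
and NO shrinking of `ρ₀`: the crux window `InWindow κ ρ N n` is exactly `2π‖n‖_∞/L ≤ 2πκ√ρ`). A statement of the proof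
plan, not a result in print. -/
def WindowAssemblyTLow : Prop :=
  ∀ v : ℝ → ℝ≥0∞, IsRepulsiveFiniteRange v → (∫⁻ x : Space, v ‖x‖) ≠ ⊤ →
    ∀ κ ρ₀ C A : ℝ, 0 < κ → 0 < ρ₀ → 0 < C → 0 ≤ A →
      FloatingForLow v (2 * Real.pi * κ) ρ₀ C A → KLSMomentForTZero v → ∃ C' : ℝ, 0 < C' ∧ IRBoundZeroWith v κ ρ₀ C'

/-- **Stub S9a statement — channels from sector gaps, at fixed `(N, L) = (m+2, L)`** (the functional-analytic core of
the arrow `C⁺ ⇒ S1₀`). Data: a mode `n ≠ 0` with `p = 2πn/L`, a bound `b > 0`, an a-priori occupation bound `n_k(Ψ) ≤ B`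
valid for all momentum-zero `δ₁`-near-minimisers, finite sector energies `E₊ = E_{N+1}(p)`, `E₋ = E_{N−1}(p)`, and a real
`μ` with the two SECTOR GAPS `E₀ + μ + (B+1)/b ≤ E₊` and `E₀ − μ + B/b ≤ E₋`. Conclusion: `ChanPlusZero` against `E₀ + μ` and
`ChanMinusZero` against `E₀ − μ`, bound `b`. Plan (all inputs landed in the `WF` toolkit): for a momentum-zero near-minimiser
`Ψ` the test vector `a†(φ_n)ψ` is a core function of total momentum `p` (`WF.isCore_modeCr`, `WF.hasTotalMomentum_modeCr`) with
`‖a†ψ‖² = n_k + 1` (`WF.normSq_modeCr`) and finite energy (`WF.qform_modeCr_le`), so `E₊(n_k+1) ≤ 𝓔[a†ψ]`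
(`WF.momentumSectorEnergy_mul_normSq_le`), whence `𝓔[a†ψ] − (E₀+μ)(n_k+1) ≥ ((B+1)/b)(n_k+1) ≥ (n_k+1)²/b ≥ 0` and the
`η`-regularised inequality follows; the hole channel likewise with `a(φ_n)ψ` of momentum `−p`
(`WF.hasTotalMomentum_modeAn`, `momentumSectorEnergy_neg`, `WF.normSq_modeAn`, `WF.qform_modeAn_le`). Provable now. -/
def ChannelsOfSectorGaps : Prop :=
  ∀ v : ℝ → ℝ≥0∞, IsRepulsiveFiniteRange v → (∫⁻ x : Space, v ‖x‖) ≠ ⊤ →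
    ∀ (m : ℕ) (L : ℝ), 0 < L → ∀ n : Fin 3 → ℤ, n ≠ 0 → ∀ (b B μ : ℝ) (δ₁ : ℝ≥0∞), 0 < b → 0 ≤ B → 0 < δ₁ →
      (∀ Ψ : PeriodicTrialState (m + 2) L, NearMinAt v δ₁ Ψ → HasTotalMomentum 0 Ψ.ψ →
          (cellOccupation (m + 2) L (planeWaveMode L n) Ψ.ψ).toReal ≤ B) →
      periodicGroundStateEnergy v (m + 2) L ≠ ⊤ →
      momentumSectorEnergy v (m + 2 + 1) L (latticeVec (2 * Real.pi / L) n) ≠ ⊤ →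
      momentumSectorEnergy v (m + 1) L (latticeVec (2 * Real.pi / L) n) ≠ ⊤ →
      (periodicGroundStateEnergy v (m + 2) L).toReal + μ + (B + 1) / b ≤
          (momentumSectorEnergy v (m + 2 + 1) L (latticeVec (2 * Real.pi / L) n)).toReal →
      (periodicGroundStateEnergy v (m + 2) L).toReal - μ + B / b ≤
          (momentumSectorEnergy v (m + 1) L (latticeVec (2 * Real.pi / L) n)).toReal →
      ChanPlusZero v m L n ((periodicGroundStateEnergy v (m + 2) L).toReal + μ) b ∧
        ChanMinusZero v m L n ((periodicGroundStateEnergy v (m + 2) L).toReal - μ) b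

/-- **Stub S9c statement — lattice-momentum sector energies are finite for integrable potentials**: for measurable
`v` with `∫ v(|x|)dx < ∞`, `M ≥ 1` particles and `L > 0`, `E_M(2πn/L; L) < ⊤` for every `n ∈ ℤ³`. Plan: the sector
variational principle at the symmetrised plane wave (`momentumSectorEnergy_latticeVec_le_planeWave`), whose energy is
finite because `|planeWaveSum| ≤ M` (`norm_planeWaveSum_le`) and the periodised pair potential is integrable over the cell
(as in `ZeroMomentumGround.periodicGroundStateEnergy_ne_top_of_lintegral_ne_top`). A statement of the proof plan
(provable now), not a result in print. -/
def LatticeSectorEnergyFinite : Prop :=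
  ∀ v : ℝ → ℝ≥0∞, Measurable v → (∫⁻ x : Space, v ‖x‖) ≠ ⊤ →
    ∀ (M : ℕ) (L : ℝ), 0 < M → 0 < L → ∀ n : Fin 3 → ℤ,
      momentumSectorEnergy v M L (latticeVec (2 * Real.pi / L) n) ≠ ⊤

/-- **Line 1's `C⁺` gives the v9 load, per potential with `∫v ≠ 0`, low window** (the corrected form of part 1's
`LinearFloorGivesFloatingZero`). For every `K > 0`: data `ρ₀, C', A` with `FloatingForLow v K ρ₀ C' A`. -/
def LinearFloorGivesFloatingLow : Prop :=
  ∀ v : ℝ → ℝ≥0∞, IsRepulsiveFiniteRange v → (∫⁻ x : Space, v ‖x‖) ≠ ⊤ → (∫⁻ x : Space, v ‖x‖) ≠ 0 →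
    LinearFloorFor v → ∀ K : ℝ, 0 < K → ∃ ρ₀ : ℝ, 0 < ρ₀ ∧ ∃ C : ℝ, 0 < C ∧ ∃ A : ℝ, 0 ≤ A ∧
      FloatingForLow v K ρ₀ C A

/-- **Stub S9b statement — the assembly of the `C⁺`-arrow from S9c and S9a.** Plan (strategist s2 census v3 §1.4 made
exact by momentum zero; filters and real arithmetic only): fix `K > 0`, `κ := K/(2π)`. (1) `C⁺ ⇒ IRBoundFor v` is LANDED
(`irBoundFor_of_linearFloor_of_integrable`): data `ρ₀ˣ, C_X`, and for `ρ < ρ₀ˣ` eventually in `N` a slack `δ_X` with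
`n_k(Ψ) ≤ B := C_X√ρL/‖n‖_∞` on `InWindow κ ρ N n` (= the low window `2π‖n‖_∞/L ≤ K√ρ`) — in particular for momentum-zero
near-minimisers; (2) the floor `LinearFloorFor v` at window constant `3K²` (`‖p‖² = (2π/L)²·nsq n ≤ 3K²ρ`,
`TransferArith.norm_latticeVec_eq`, `sqrt_nsq_le_sqrt_three_mul_norm`): data `θ, ρ₀ᶠ`, and eventually in `N`,
`2E₀ + 2θ√ρ‖p‖ ≤ E₊ + E₋`, read in `ℝ` by S9c (finiteness) with `‖p‖ ≥ 2π‖n‖_∞/L`; (3) constants `ρ₀ := min ρ₀ˣ ρ₀ᶠ`,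
`C' ≥ (2C_X + κ)/(4πθ)`, `A ≥ κ²(C_X + 1)/C'`, `b := C'L²/‖n‖²`: on the window `1 ≤ ‖n‖_∞ ≤ κ√ρL` one checks
`(2B+1)/b ≤ 4πθ√ρ‖n‖_∞/L ≤ E₊ + E₋ − 2E₀` and `(B+1)/b ≤ Aρ`; (4) `μ := E₊ − E₀ − (B+1)/b` satisfies both sector gaps of
S9a (the hole gap is the floor) and `μ ≥ −(B+1)/b ≥ −Aρ` because `E₊ ≥ E₀(N+1) ≥ E₀(N)`
(`periodicGroundStateEnergy_le_momentumSectorEnergy`, `WF.periodicGroundStateEnergy_le_succ`); take `μ₊ = μ₋ = μ`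
(coupling slack `ε√(ρa)/L ≥ 0` unused). Provable now. -/
def LinearFloorGivesFloatingLowOf : Prop :=
  LatticeSectorEnergyFinite → ChannelsOfSectorGaps → LinearFloorGivesFloatingLow

/-- **Stub S9' statement — the a.e.-free potentials carry the v9 load (low window)**: an admissible `v` with
`∫ v(|x|)dx = 0` has, for every `K > 0`, data with `FloatingForLow v K ρ₀ C A`. Plan: c22's `floatingFor_zero`
(p154826: `FloatingFor 0 K ρ₀ C` for `C ≥ 1/(4π²)`, `μ₊ = μ₋ = 0`) transported along the a.e.-class of `v ∘ |·|`
(`Negative.AEClass`: `periodicEnergy_congr_ae`, `periodicGroundStateEnergy_congr_ae`, `periodicInteraction_congr_ae`; the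
coupling term only needs `0 ≤ ε√(ρa)/L`), then `floatingForZero_of_floatingFor` and `floatingForLow_of_floatingForZero`.
Provable now. -/
def AeZeroFloatingLow : Prop :=
  ∀ v : ℝ → ℝ≥0∞, IsRepulsiveFiniteRange v → (∫⁻ x : Space, v ‖x‖) = 0 →
    ∀ K : ℝ, 0 < K → ∃ ρ₀ : ℝ, 0 < ρ₀ ∧ ∃ C : ℝ, 0 < C ∧ ∃ A : ℝ, 0 ≤ A ∧ FloatingForLow v K ρ₀ C A

/-! ## §3 Sorry-free glue -/

/-- **Fixed ball ⇒ low window**: `FloatingForZero v K₁ ρ₀ C A` gives `FloatingForLow v K (min ρ₀ (K₁/K)²) C A` for every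
`K > 0` (for `ρ < (K₁/K)²` the low window `|p| ≤ K√ρ` sits inside the ball `|p| ≤ K₁`). [folklore] -/
theorem floatingForLow_of_floatingForZero {v : ℝ → ℝ≥0∞} {K₁ ρ₀ C A K : ℝ} (hK₁ : 0 < K₁) (hK : 0 < K)
    (h : FloatingForZero v K₁ ρ₀ C A) : FloatingForLow v K (min ρ₀ ((K₁ / K) ^ 2)) C A := by
  intro ε hε ρ hρ hρlt
  have hρ₀ : ρ < ρ₀ := hρlt.trans_le (min_le_left _ _)
  have hρK : ρ < (K₁ / K) ^ 2 := hρlt.trans_le (min_le_right _ _)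
  have hsq : K * Real.sqrt ρ ≤ K₁ := by
    have h1 : Real.sqrt ρ < K₁ / K := (Real.sqrt_lt' (by positivity)).2 hρK
    calc K * Real.sqrt ρ ≤ K * (K₁ / K) := mul_le_mul_of_nonneg_left h1.le hK.le
      _ = K₁ := by field_simp
  filter_upwards [h ε hε ρ hρ hρ₀] with m hm n hn hwin
  exact hm n hn (hwin.trans hsq)

/-- **`FloatingTwoChannelZero` (part 1) ⇒ S1₀.** [folklore] -/
theorem floatingTwoChannelLow_of_floatingTwoChannelZero (h : FloatingTwoChannelZero) : FloatingTwoChannelLow := by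
  intro v hv hint K hK
  obtain ⟨K₁, hK₁, ρ₀, hρ₀, C, hC, A, hA, hF⟩ := h v hv hint
  exact ⟨min ρ₀ ((K₁ / K) ^ 2), lt_min hρ₀ (by positivity), C, hC, A, hA,
    floatingForLow_of_floatingForZero hK₁ hK hF⟩

/-- **S1' ⇒ S1₀**: the v8 pooled stub implies the v9 one. [folklore] -/
theorem floatingTwoChannelLow_of_floatingTwoChannel (h : FloatingTwoChannel) : FloatingTwoChannelLow :=
  floatingTwoChannelLow_of_floatingTwoChannelZero (floatingTwoChannelZero_of_floatingTwoChannel h)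

/-- **stmt-12620 ∧ stmt-9094 ⇒ S1₀** (through S1', p155164). [folklore] -/
theorem floatingTwoChannelLow_of_pooled (hGD : GaussianDomination) (hC : EnergyConvexityWindow) :
    FloatingTwoChannelLow :=
  floatingTwoChannelLow_of_floatingTwoChannel (stub_floatingOfPooled hGD hC)

/-- **From the low floating bound to the momentum-zero infrared bound, per potential** (S4₀-output and S5₀ as
hypotheses): `∀ K > 0, FloatingForLow v K …` and `KLSMomentForTZero v` give `IRBoundForZero v` (at `κ` use `K = 2πκ`).
[folklore] -/
theorem irBoundForZero_of_floatingLow {v : ℝ → ℝ≥0∞} (hv : IsRepulsiveFiniteRange v)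
    (hint : (∫⁻ x : Space, v ‖x‖) ≠ ⊤)
    (hF : ∀ K : ℝ, 0 < K → ∃ ρ₀ : ℝ, 0 < ρ₀ ∧ ∃ C : ℝ, 0 < C ∧ ∃ A : ℝ, 0 ≤ A ∧ FloatingForLow v K ρ₀ C A)
    (h4 : KLSMomentForTZero v) (h5 : WindowAssemblyTLow) : IRBoundForZero v := by
  intro κ hκ
  obtain ⟨ρ₀, hρ₀, C, hC, A, hA, hFK⟩ := hF (2 * Real.pi * κ) (by positivity)
  obtain ⟨C', hC', hIR⟩ := h5 v hv hint κ ρ₀ C A hκ hρ₀ hC hA hFK h4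
  exact ⟨ρ₀, hρ₀, C', hC', hIR⟩

/-- **The integrable half of the crux from S1₀, S4₀, S5₀.** [folklore] -/
theorem integrableHalf_of_floatingLow (h1 : FloatingTwoChannelLow) (h4 : KLSNearMinimiserTZero)
    (h5 : WindowAssemblyTLow) :
    ∀ v : ℝ → ℝ≥0∞, IsRepulsiveFiniteRange v → (∫⁻ x : Space, v ‖x‖) ≠ ⊤ → IRBoundFor v :=
  fun v hv hint => irBoundFor_of_irBoundForZero hv hint
    (irBoundForZero_of_floatingLow hv hint (h1 v hv hint) (h4 v hv hint) h5)

/-- **Registered by-product `stub_integrableHalfOfFloatingLow` of the crux ledger** (line `two-sector-gd-transfer`, v9):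
S1₀ ∧ S4₀ ∧ S5₀ give `IRBoundFor v` for every INTEGRABLE admissible `v`. [folklore] -/
theorem stub_integrableHalfOfFloatingLow :
    FloatingTwoChannelLow → KLSNearMinimiserTZero → WindowAssemblyTLow →
      ∀ v : ℝ → ℝ≥0∞, IsRepulsiveFiniteRange v → (∫⁻ x : Space, v ‖x‖) ≠ ⊤ → IRBoundFor v :=
  integrableHalf_of_floatingLow

/-- **`PeriodicIRBound` by name from S1₀, S4₀, S5₀ and the scope half S6 `NonIntegrableHalf`.** [folklore] -/
theorem periodicIRBound_of_floatingLow (h1 : FloatingTwoChannelLow) (h4 : KLSNearMinimiserTZero)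
    (h5 : WindowAssemblyTLow) (h6 : NonIntegrableHalf) : PeriodicIRBound :=
  periodicIRBound_iff_split.2 ⟨integrableHalf_of_floatingLow h1 h4 h5, h6⟩

/-- The `C⁺`-arrow assembled from its three stubs. [folklore] -/
theorem linearFloorGivesFloatingLow_of (h9c : LatticeSectorEnergyFinite) (h9a : ChannelsOfSectorGaps)
    (h9b : LinearFloorGivesFloatingLowOf) : LinearFloorGivesFloatingLow :=
  h9b h9c h9a

/-- **Line 1's `C⁺` gives S1₀** (modulo the arrow for `∫v ≠ 0` and S9' for `∫v = 0`). [folklore] -/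
theorem floatingTwoChannelLow_of_linearFloor (h9 : LinearFloorGivesFloatingLow) (h9' : AeZeroFloatingLow)
    (hC : LinearParticleHoleFloor) : FloatingTwoChannelLow := by
  intro v hv hint K hK
  by_cases h0 : (∫⁻ x : Space, v ‖x‖) = 0
  · exact h9' v hv h0 K hK
  · exact h9 v hv hint h0 (hC v hv h0) K hK

end Summit.AtomisticToContinuum.BoseEinsteinCondensation.Cruxes.PeriodicIRBound.TwoSectorGdTransfer

end
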